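import Literature.Computability.AlgebraicComplexity.FactorSystems
import HarnessLib

/-!
# Normalized circuits, their clones and tokens, and the associated factor system

The combinatorial data of the constant-free completeness proof for the permanent behind
Bürgisser 2009, Thm. 2.10 (`ConstantFreeCompleteness.Burgisser2009_perProjection`), following
Malod–Portier 2008 (Lemma 2: the *reduced* circuit on the pairs `[i, α]` = (formal degree slot,
gate), in which all parse trees are read off locally; Thm. 2: `VNP = VNP_e` by summing, over
Boolean edge variables, the product of local conditions (1)–(4) characterising a parse tree).
Here the pairs `[i, α]` are the CLONES `(node, offset)`, the edge variables are the TOKENS, and the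
local conditions are the factor kinds of `FactorSystems.lean`, arranged so that every Boolean
variable is read by exactly two factors (the hypothesis of `FactorSystem.exists_permanent`).

* `NK R`, `NCirc R` — normalized circuits in certificate style (like `DepthReduction.SLP`): `m`
  nodes, the first `u` of them the Boolean leaves `e_0, …, e_{u-1}` (kind `evar`), the others ring
  leaves `leaf ℓ`, products `mul a b`, sums `add a b`, coefficient nodes `pass c a` of EARLIER
  nodes, with the formal degrees `fd` (`NK.fdeg`) and the values `val e i` at every Boolean point
  `e` of the Boolean leaves (`NK.eval`) and their local equations; `NCirc.one_le_fd`.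
* `NCirc.Clone N D = Fin m × Fin (D+1)` (clone codes `(i, c)`, VALID when `c + fd i ≤ D`,
  `CValid`), `Tok` (one token per valid clone and child position), `Aux` (the chain variables
  `a_{k,c}` of the Boolean leaves), `Var = Tok ⊕ (Unit ⊕ Aux)` (`t₀` = the root demand);
  `tgt`/`tgt_spec` (a product clone `(i, c)` sends its tokens to `(a, c)` and `(b, c + fd a)`, a
  sum clone to `(a, c)` and `(b, c)`, a coefficient clone to `(a, c)`: targets are valid clones of
  earlier nodes with ranges `[c', c' + fd) ⊆ [c, c + fd i)`), `src`, `tgtV`.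
* `NCirc.ins` (incoming variables of a clone: the tokens targeting it, and `t₀` for the root
  clone `(m-1, 0)`), `cloneKind` (the factor of a clone: `mul/add/pass/leaf` by the kind of its
  node, `chain₀`/`chain` for the clones of a Boolean leaf, the constant `1` for invalid codes),
  `Φ = Clone ⊕ (Fin 1 ⊕ Fin u)` (factor indices: clones, the root factor `top t₀`, one chain end
  `fin` per Boolean leaf), `mF`, `dec`/`enc`, `kindΦ`/`kindF`.
* `NCirc.occ` — the two occurrences of each variable — and `occ_spec`, `occ_surj`, `occ_ne`;
* `NCirc.FS N D hD hm hroot : FactorSystem R` — **the factor system of a normalized circuit**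
  with budget `D ≥ fd (m-1)`, `D ≥ 1`.

The sibling `TokenExpansion.lean` proves `∑_b ∏_f F f b = ∑_e val e (m-1)` for every admissible
`F` (the cut induction over the node order).

## References

* G. Malod, N. Portier, *Characterizing Valiant's algebraic complexity classes*, J. Complexity
  24 (2008) 16–38: Lemma 2 (reduced circuits, p. 7 of the MFCS version) and Thm. 2 with its
  proof (conditions (1)–(4), pp. 8–9).
* P. Bürgisser, *On defining integers and proving arithmetic circuit lower bounds*,
  Comput. Complexity 18 (2009) 81–103, Thm. 2.10 (ECCC TR06-113, p. 8).
-/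

namespace Literature.Computability.AlgebraicComplexity

open Finset

universe u

/-! ### Normalized circuits -/

/-- Node kinds of a normalized circuit over `R`: a ring leaf, a Boolean leaf (the `e`-variables
of a Boolean sum; by convention the Boolean leaves are the first nodes, node `i` carrying the
variable `e_i`), a product / sum of two earlier nodes, a coefficient times an earlier node. [folklore] -/
inductive NK (R : Type u) : Type u
  /-- a leaf labelled by a ring element -/
  | leaf (ℓ : R)
  /-- a Boolean leaf -/
  | evar
  /-- product of the nodes `a, b` -/
  | mul (a b : ℕ)
  /-- sum of the nodes `a, b` -/
  | add (a b : ℕ)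
  /-- `c` times the node `a` -/
  | pass (c : R) (a : ℕ)

namespace NK

variable {R : Type u}

/-- The children of a node. [folklore] -/
def children : NK R → List ℕ
  | leaf _ => []
  | evar => []
  | mul a b => [a, b]
  | add a b => [a, b]
  | pass _ a => [a]

/-- Number of children (= number of outgoing tokens of each clone). [folklore] -/
def ar : NK R → ℕ
  | leaf _ => 0
  | evar => 0
  | mul _ _ => 2
  | add _ _ => 2
  | pass _ _ => 1

/-- The formal degree recursion: leaves `1`, products add, sums take the maximum, coefficients
keep (Bürgisser 2009, §2.2). [cite: Burgisser2006, §2.2] -/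
def fdeg (d : ℕ → ℕ) : NK R → ℕ
  | leaf _ => 1
  | evar => 1
  | mul a b => d a + d b
  | add a b => max (d a) (d b)
  | pass _ a => d a

/-- The value recursion at a Boolean point `e` of the Boolean leaves. [folklore] -/
def eval [CommRing R] (e : ℕ → Bool) (i : ℕ) (v : ℕ → R) : NK R → R
  | leaf ℓ => ℓ
  | evar => if e i then 1 else 0
  | mul a b => v a * v b
  | add a b => v a + v b
  | pass c a => c * v a

end NK

/-- **A normalized circuit** (certificate style, like `SLP`): `m` nodes, the first `u` of which
are the Boolean leaves `e_0, …, e_{u-1}`, every other node a ring leaf / product / sum /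
coefficient node referring to EARLIER nodes; with its formal degrees and its values at every
Boolean point of the Boolean leaves, and the local equations they satisfy. Nodes `≥ m` are junk. [folklore] -/
structure NCirc (R : Type u) [CommRing R] where
  /-- number of Boolean leaves -/
  u : ℕ
  /-- number of nodes -/
  m : ℕ
  u_le : u ≤ m
  /-- kind of each node -/
  kind : ℕ → NK R
  kind_evar : ∀ i < m, kind i = NK.evar ↔ i < u
  /-- children are earlier nodes -/
  wf : ∀ i < m, ∀ a ∈ (kind i).children, a < i
  /-- formal degrees -/
  fd : ℕ → ℕ
  fd_eq : ∀ i < m, fd i = (kind i).fdeg fd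
  /-- values at the Boolean points (`e` extended by `false` beyond `u`) -/
  val : (ℕ → Bool) → ℕ → R
  val_eq : ∀ e, ∀ i < m, val e i = (kind i).eval e i (val e)

namespace NCirc

variable {R : Type u} [CommRing R] (N : NCirc R)

/-- Formal degrees are positive. [cite: Burgisser2006, §2.2] -/
theorem one_le_fd : ∀ i < N.m, 1 ≤ N.fd i := by
  intro i
  induction i using Nat.strong_induction_on with
  | _ i ih =>
    intro hi
    rw [N.fd_eq i hi]
    have hw := N.wf i hi
    cases hk : N.kind i with
    | leaf ℓ => simp [NK.fdeg]
    | evar => simp [NK.fdeg]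
    | mul a b =>
      rw [hk] at hw
      have ha := ih a (hw a (by simp [NK.children])) ((hw a (by simp [NK.children])).trans hi)
      simp only [NK.fdeg]
      omega
    | add a b =>
      rw [hk] at hw
      have ha := ih a (hw a (by simp [NK.children])) ((hw a (by simp [NK.children])).trans hi)
      simp only [NK.fdeg]
      omega
    | pass c a =>
      rw [hk] at hw
      exact ih a (hw a (by simp [NK.children])) ((hw a (by simp [NK.children])).trans hi)

/-! ### Clones, tokens, targets -/

section Clones

variable (D : ℕ)

/-- Clone codes: (node, offset). A clone `(i, c)` stands for a copy of node `i` responsible for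
the leaf positions `[c, c + fd i)` of a parse tree; it is VALID if `c + fd i ≤ D`
(Malod–Portier 2008, proof of Lemma 2). [cite: MalodPortier2008, Lemma 2] -/
abbrev Clone : Type := Fin N.m × Fin (D + 1)

/-- Validity of a clone: its range fits into the budget `D`. [cite: MalodPortier2008, Lemma 2] -/
def CValid (κ : N.Clone D) : Prop := κ.2.val + N.fd κ.1 ≤ D

/-- Validity of a clone is decidable. [folklore] -/
instance (κ : N.Clone D) : Decidable (N.CValid D κ) := by unfold CValid; infer_instance

/-- Token variables: one per valid clone and child position. [folklore] -/
abbrev Tok : Type := {p : N.Clone D × Fin 2 // N.CValid D p.1 ∧ p.2.val < (N.kind p.1.1).ar}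

/-- Chain variables `a_{k,c}` of the Boolean leaf `k`, one per valid clone `(k, c)` (`c + 1 ≤ D`). [folklore] -/
abbrev Aux : Type := {q : Fin N.u × Fin (D + 1) // q.2.val + 1 ≤ D}

/-- All Boolean variables: tokens, the root demand `t₀`, chain variables. [folklore] -/
abbrev Var : Type := N.Tok D ⊕ (Unit ⊕ N.Aux D)

/-- The target (node, offset) of the `j`-th outgoing token of a clone `(i, c)`:
products send `(a, c)` and `(b, c + fd a)`, sums `(a, c)` and `(b, c)`, coefficient nodes `(a, c)`
(Malod–Portier 2008, proof of Lemma 2: "γ_i receives an arrow from α_i and from β_{i+e₁}"). [cite: MalodPortier2008, Lemma 2] -/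
def tgtOf (c j : ℕ) : NK R → ℕ × ℕ
  | NK.mul a b => if j = 0 then (a, c) else (b, c + N.fd a)
  | NK.add a b => if j = 0 then (a, c) else (b, c)
  | NK.pass _ a => (a, c)
  | _ => (0, 0)

/-- The target of a token. [cite: MalodPortier2008, Lemma 2] -/
def tgt (τ : N.Tok D) : ℕ × ℕ := N.tgtOf τ.1.1.2.val τ.1.2.val (N.kind τ.1.1.1.val)

/-- The demand-carrying variables and their targets: tokens, and `t₀` targeting the root clone
`(m - 1, 0)`; chain variables carry no demand. [folklore] -/
def tgtV : N.Var D → Option (ℕ × ℕ)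
  | Sum.inl τ => some (N.tgt D τ)
  | Sum.inr (Sum.inl _) => some (N.m - 1, 0)
  | Sum.inr (Sum.inr _) => none

/-- The source node of a variable: the node of the clone a token leaves from, `m` for `t₀`, the
Boolean leaf of a chain variable. [folklore] -/
def src : N.Var D → ℕ
  | Sum.inl τ => τ.1.1.1.val
  | Sum.inr (Sum.inl _) => N.m
  | Sum.inr (Sum.inr q) => q.1.1.val

/-- **Targets of tokens are valid clones of earlier nodes.** [cite: MalodPortier2008, Lemma 2] -/
theorem tgt_spec (τ : N.Tok D) :
    (N.tgt D τ).1 < τ.1.1.1.val ∧ (N.tgt D τ).2 + N.fd (N.tgt D τ).1 ≤ D ∧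
      τ.1.1.2.val ≤ (N.tgt D τ).2 ∧
      (N.tgt D τ).2 + N.fd (N.tgt D τ).1 ≤ τ.1.1.2.val + N.fd τ.1.1.1.val := by
  obtain ⟨⟨⟨i, c⟩, j⟩, hval, hj⟩ := τ
  simp only [tgt]
  have hi : i.val < N.m := i.isLt
  have hw := N.wf i hi
  have hfd := N.fd_eq i hi
  unfold CValid at hval
  simp only at hval hj ⊢
  cases hk : N.kind i.val with
  | leaf ℓ => simp [hk, NK.ar] at hj
  | evar => simp [hk, NK.ar] at hj
  | mul a b =>
    rw [hk] at hw hfd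
    simp only [NK.fdeg] at hfd
    have ha : a < i.val := hw a (by simp [NK.children])
    have hb : b < i.val := hw b (by simp [NK.children])
    simp only [tgtOf]
    split_ifs with h
    · simp only
      omega
    · simp only
      omega
  | add a b =>
    rw [hk] at hw hfd
    simp only [NK.fdeg] at hfd
    have ha : a < i.val := hw a (by simp [NK.children])
    have hb : b < i.val := hw b (by simp [NK.children])
    simp only [tgtOf]
    split_ifs with h
    · simp only
      omega
    · simp only
      omega
  | pass c' a =>
    rw [hk] at hw hfd
    simp only [NK.fdeg] at hfd
    have ha : a < i.val := hw a (by simp [NK.children])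
    simp only [tgtOf]
    omega

end Clones

/-! ### The factors of the clones -/

section Factors

variable (D : ℕ)

/-- The root demand variable `t₀`. [folklore] -/
def t0 : N.Var D := Sum.inr (Sum.inl ())

/-- The tokens targeting a clone. [folklore] -/
noncomputable def insToks (κ : N.Clone D) : List (N.Tok D) :=
  (univ.filter fun τ : N.Tok D => N.tgt D τ = (κ.1.val, κ.2.val)).toList

/-- The root clone `(m - 1, 0)`. [folklore] -/
def IsRoot (κ : N.Clone D) : Prop := κ.1.val = N.m - 1 ∧ κ.2.val = 0

/-- Being the root clone is decidable. [folklore] -/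
instance (κ : N.Clone D) : Decidable (N.IsRoot D κ) := by unfold IsRoot; infer_instance

/-- The incoming variables of a clone: its incoming tokens, and `t₀` for the root clone. [folklore] -/
noncomputable def ins (κ : N.Clone D) : List (N.Var D) :=
  (N.insToks D κ).map Sum.inl ++ if N.IsRoot D κ then [N.t0 D] else []

/-- The incoming lists have no duplicates. [folklore] -/
theorem nodup_ins (κ : N.Clone D) : (N.ins D κ).Nodup := by
  unfold ins insToks
  refine List.Nodup.append ((Finset.nodup_toList _).map Sum.inl_injective) ?_ ?_
  · split_ifs <;> simp
  · intro x hx hy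
    simp only [List.mem_map] at hx
    obtain ⟨τ, -, rfl⟩ := hx
    split_ifs at hy <;> simp [t0] at hy

/-- A token variable of a valid clone. [folklore] -/
def tokVar (κ : N.Clone D) (j : Fin 2) (h : N.CValid D κ ∧ j.val < (N.kind κ.1.val).ar) : N.Var D :=
  Sum.inl ⟨(κ, j), h⟩

/-- A chain variable. [folklore] -/
def auxVar (k : Fin N.u) (c : Fin (D + 1)) (h : c.val + 1 ≤ D) : N.Var D :=
  Sum.inr (Sum.inr ⟨(k, c), h⟩)

/-- For a valid clone of a Boolean leaf, the chain variables exist. [folklore] -/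
theorem aux_cond {κ : N.Clone D} (hv : N.CValid D κ) {k : NK R} (hk : N.kind κ.1.val = k)
    (hke : k = NK.evar) : κ.1.val < N.u ∧ κ.2.val + 1 ≤ D := by
  subst hke
  refine ⟨(N.kind_evar κ.1.val κ.1.isLt).1 hk, ?_⟩
  have h := N.fd_eq κ.1.val κ.1.isLt
  rw [hk] at h
  simp only [NK.fdeg] at h
  unfold CValid at hv
  omega

/-- The factor of a valid clone of a Boolean leaf: `chain₀` at offset `0`, `chain` otherwise. [folklore] -/
noncomputable def evarKind (κ : N.Clone D) (hu : κ.1.val < N.u) (hc : κ.2.val + 1 ≤ D) :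
    (c : ℕ) → κ.2.val = c → FKind R (N.Var D)
  | 0, _ => FKind.chain₀ (N.auxVar D ⟨κ.1.val, hu⟩ κ.2 hc) (N.ins D κ)
  | c + 1, h => FKind.chain (N.auxVar D ⟨κ.1.val, hu⟩ ⟨c, by omega⟩ (by simp only; omega))
      (N.auxVar D ⟨κ.1.val, hu⟩ κ.2 hc) (N.ins D κ)

/-- The factor of a valid clone, by the kind of its node (see `cloneKind`). [cite: MalodPortier2008, Thm. 2] -/
noncomputable def cloneKindOf (κ : N.Clone D) (hv : N.CValid D κ) :
    (k : NK R) → N.kind κ.1.val = k → FKind R (N.Var D)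
  | NK.leaf ℓ, _ => FKind.leaf ℓ (N.ins D κ)
  | NK.evar, hk => N.evarKind D κ (N.aux_cond D hv hk rfl).1 (N.aux_cond D hv hk rfl).2 κ.2.val rfl
  | NK.mul _ _, hk => FKind.mul (N.tokVar D κ 0 ⟨hv, by simp [hk, NK.ar]⟩)
      (N.tokVar D κ 1 ⟨hv, by simp [hk, NK.ar]⟩) (N.ins D κ)
  | NK.add _ _, hk => FKind.add (N.tokVar D κ 0 ⟨hv, by simp [hk, NK.ar]⟩)
      (N.tokVar D κ 1 ⟨hv, by simp [hk, NK.ar]⟩) (N.ins D κ)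
  | NK.pass c _, hk => FKind.pass c (N.tokVar D κ 0 ⟨hv, by simp [hk, NK.ar]⟩) (N.ins D κ)

/-- **The factor of a clone** (Malod–Portier 2008, proof of Thm. 2, conditions (2)–(3), in
token form): a product clone passes its demand to both children (`mul`), a sum clone to exactly
one (`add`), a coefficient clone to its child with weight `c` (`pass`), a ring leaf has weight
`ℓ` when demanded (`leaf`), the clones of a Boolean leaf carry the AND-chain of "not demanded"
(`chain₀` / `chain`); invalid clone codes get the constant factor `1`. [cite: MalodPortier2008, Thm. 2] -/
noncomputable def cloneKind (κ : N.Clone D) : FKind R (N.Var D) :=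
  if hv : N.CValid D κ then N.cloneKindOf D κ hv (N.kind κ.1.val) rfl else FKind.leaf 1 []

/-- Unfolding `cloneKind` at a known node kind. [folklore] -/
theorem cloneKind_eq (κ : N.Clone D) (hv : N.CValid D κ) {k : NK R} (hk : N.kind κ.1.val = k) :
    N.cloneKind D κ = N.cloneKindOf D κ hv k hk := by
  unfold cloneKind
  rw [dif_pos hv]
  subst hk
  rfl

/-- Unfolding `cloneKind` at an invalid clone. [folklore] -/
theorem cloneKind_of_not (κ : N.Clone D) (hv : ¬ N.CValid D κ) :
    N.cloneKind D κ = FKind.leaf 1 [] := by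
  unfold cloneKind
  rw [dif_neg hv]

/-- The factor index type: clone codes, the root factor, one chain end per Boolean leaf. [folklore] -/
abbrev Φ : Type := N.Clone D ⊕ (Fin 1 ⊕ Fin N.u)

/-- The number of factors. [folklore] -/
def mF : ℕ := N.m * (D + 1) + (1 + N.u)

/-- Decoding factor indices. [folklore] -/
def dec : Fin (N.mF D) ≃ N.Φ D :=
  finSumFinEquiv.symm.trans (Equiv.sumCongr finProdFinEquiv.symm finSumFinEquiv.symm)

/-- Encoding factor indices. [folklore] -/
def enc : N.Φ D → Fin (N.mF D) := (N.dec D).symm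

/-- Decoding an encoded factor index. [folklore] -/
@[simp] theorem dec_enc (x : N.Φ D) : N.dec D (N.enc D x) = x := Equiv.apply_symm_apply _ _

/-- Encoding is injective. [folklore] -/
theorem enc_injective : Function.Injective (N.enc D) := (N.dec D).symm.injective

/-- The kind of a factor: clone factors, the root factor `[t₀]`, the chain ends `1 + [a_{k,D-1}]`. [folklore] -/
noncomputable def kindΦ (hD : 1 ≤ D) : N.Φ D → FKind R (N.Var D)
  | Sum.inl κ => N.cloneKind D κ
  | Sum.inr (Sum.inl _) => FKind.top (N.t0 D)
  | Sum.inr (Sum.inr k) => FKind.fin (N.auxVar D k ⟨D - 1, by omega⟩ (by simp only; omega))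

/-- The kind of an encoded factor. [folklore] -/
noncomputable def kindF (hD : 1 ≤ D) (f : Fin (N.mF D)) : FKind R (N.Var D) := N.kindΦ D hD (N.dec D f)

/-- `kindF ∘ enc = kindΦ`. [folklore] -/
@[simp] theorem kindF_enc (hD : 1 ≤ D) (x : N.Φ D) : N.kindF D hD (N.enc D x) = N.kindΦ D hD x := by
  simp [kindF]

/-- The kind of a clone factor. [folklore] -/
@[simp] theorem kindΦ_inl (hD : 1 ≤ D) (κ : N.Clone D) : N.kindΦ D hD (Sum.inl κ) = N.cloneKind D κ := rfl

/-- The kind of the root factor. [folklore] -/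
@[simp] theorem kindΦ_root (hD : 1 ≤ D) (z : Fin 1) :
    N.kindΦ D hD (Sum.inr (Sum.inl z)) = FKind.top (N.t0 D) := rfl

/-- The kind of a chain end. [folklore] -/
@[simp] theorem kindΦ_fin (hD : 1 ≤ D) (k : Fin N.u) :
    N.kindΦ D hD (Sum.inr (Sum.inr k)) = FKind.fin (N.auxVar D k ⟨D - 1, by omega⟩ (by simp only; omega)) := rfl

end Factors

/-! ### The two occurrences of each variable -/

section Occ

variable (D : ℕ)

/-- The position of a variable in a list (the first index holding it). [folklore] -/
def posIn (l : List (N.Var D)) (v : N.Var D) : ℕ := l.findIdx fun w => decide (w = v)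

/-- The position of a member is in range. [folklore] -/
theorem posIn_lt {l : List (N.Var D)} {v : N.Var D} (h : v ∈ l) : N.posIn D l v < l.length :=
  List.findIdx_lt_length_of_exists ⟨v, h, by simp⟩

/-- The list holds the variable at its position. [folklore] -/
theorem getElem_posIn {l : List (N.Var D)} {v : N.Var D} (h : v ∈ l) :
    l[N.posIn D l v]'(N.posIn_lt D h) = v := by
  have h1 := List.findIdx_getElem (w := N.posIn_lt D h)
  simp only [decide_eq_true_eq] at h1
  exact h1

/-- In a list without duplicates the position of the `i`-th entry is `i`. [folklore] -/
theorem posIn_getElem {l : List (N.Var D)} (hl : l.Nodup) (i : ℕ) (hi : i < l.length) :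
    N.posIn D l (l[i]) = i := by
  have hmem : l[i] ∈ l := List.getElem_mem hi
  exact (hl.getElem_inj_iff).1 (N.getElem_posIn D hmem)

/-- The incoming variables of every clone factor. [folklore] -/
theorem cloneKind_ins (κ : N.Clone D) (hv : N.CValid D κ) : (N.cloneKind D κ).ins = N.ins D κ := by
  rw [N.cloneKind_eq D κ hv rfl]
  have e : ∀ (k : NK R) (h : N.kind κ.1.val = k), (N.cloneKindOf D κ hv k h).ins = N.ins D κ := by
    intro k h
    cases k with
    | leaf ℓ => rfl
    | evar =>
      simp only [cloneKindOf]
      have e2 : ∀ (c : ℕ) (hc : κ.2.val = c) hu hc',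
          (N.evarKind D κ hu hc' c hc).ins = N.ins D κ := by
        intro c hc hu hc'
        cases c <;> rfl
      exact e2 _ rfl _ _
    | mul a b => rfl
    | add a b => rfl
    | pass c a => rfl
  exact e _ rfl

/-- A clone from node and offset. [folklore] -/
def mkClone (i c : ℕ) (hi : i < N.m) (hc : c ≤ D) : N.Clone D := (⟨i, hi⟩, ⟨c, Nat.lt_succ_of_le hc⟩)

/-- The target clone of a token. [cite: MalodPortier2008, Lemma 2] -/
def tgtC (τ : N.Tok D) : N.Clone D :=
  N.mkClone D (N.tgt D τ).1 (N.tgt D τ).2 ((N.tgt_spec D τ).1.trans τ.1.1.1.isLt)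
    (by have := (N.tgt_spec D τ).2.1; omega)

/-- The target clone is valid. [cite: MalodPortier2008, Lemma 2] -/
theorem tgtC_valid (τ : N.Tok D) : N.CValid D (N.tgtC D τ) := (N.tgt_spec D τ).2.1

/-- The target clone is a clone of an earlier node. [cite: MalodPortier2008, Lemma 2] -/
theorem tgtC_node_lt (τ : N.Tok D) : (N.tgtC D τ).1.val < τ.1.1.1.val := (N.tgt_spec D τ).1

/-- A token is an incoming variable of its target clone. [folklore] -/
theorem inl_mem_ins_tgtC (τ : N.Tok D) : (Sum.inl τ : N.Var D) ∈ N.ins D (N.tgtC D τ) := by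
  unfold ins insToks
  refine List.mem_append_left _ (List.mem_map.2 ⟨τ, ?_, rfl⟩)
  rw [Finset.mem_toList, Finset.mem_filter]
  exact ⟨Finset.mem_univ _, rfl⟩

/-- Membership in the incoming list of a clone. [folklore] -/
theorem mem_ins_iff (κ : N.Clone D) (v : N.Var D) :
    v ∈ N.ins D κ ↔ (∃ τ : N.Tok D, v = Sum.inl τ ∧ N.tgt D τ = (κ.1.val, κ.2.val)) ∨
      (N.IsRoot D κ ∧ v = N.t0 D) := by
  unfold ins insToks
  rw [List.mem_append, List.mem_map]
  constructor
  · rintro (⟨τ, hτ, rfl⟩ | h)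
    · rw [Finset.mem_toList, Finset.mem_filter] at hτ
      exact Or.inl ⟨τ, rfl, hτ.2⟩
    · split_ifs at h with hr
      · exact Or.inr ⟨hr, List.mem_singleton.1 h⟩
      · simp at h
  · rintro (⟨τ, rfl, hτ⟩ | ⟨hr, rfl⟩)
    · exact Or.inl ⟨τ, by rw [Finset.mem_toList, Finset.mem_filter]; exact ⟨Finset.mem_univ _, hτ⟩, rfl⟩
    · right
      rw [if_pos hr]
      exact List.mem_singleton_self _

variable (hm : 0 < N.m)

/-- The root clone `(m - 1, 0)`. [folklore] -/
def rootC : N.Clone D := N.mkClone D (N.m - 1) 0 (by omega) (Nat.zero_le _)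

omit hm in
/-- The root clone is the only clone satisfying `IsRoot`. [folklore] -/
theorem eq_rootC_of_isRoot {hm : 0 < N.m} {κ : N.Clone D} (h : N.IsRoot D κ) : κ = N.rootC D hm := by
  obtain ⟨⟨i, hi⟩, ⟨c, hc⟩⟩ := κ
  obtain ⟨h1, h2⟩ := h
  simp only at h1 h2
  subst h1 h2
  rfl

/-- The root clone satisfies `IsRoot`. [folklore] -/
theorem isRoot_rootC : N.IsRoot D (N.rootC D hm) := ⟨rfl, rfl⟩

/-- `t₀` is an incoming variable of the root clone. [folklore] -/
theorem t0_mem_ins_rootC : N.t0 D ∈ N.ins D (N.rootC D hm) :=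
  (N.mem_ins_iff D _ _).2 (Or.inr ⟨N.isRoot_rootC D hm, rfl⟩)

/-- The root clone is valid when the budget covers the root's formal degree. [folklore] -/
theorem rootC_valid (hroot : N.fd (N.m - 1) ≤ D) : N.CValid D (N.rootC D hm) := by
  unfold CValid rootC mkClone
  simpa using hroot

/-- The clone of a chain variable. [folklore] -/
def auxClone (q : N.Aux D) : N.Clone D := (⟨q.1.1.val, lt_of_lt_of_le q.1.1.isLt N.u_le⟩, q.1.2)

omit hm in
/-- The clone of a chain variable is a valid clone of a Boolean leaf. [folklore] -/
theorem auxClone_spec (q : N.Aux D) :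
    N.kind (N.auxClone D q).1.val = NK.evar ∧ N.CValid D (N.auxClone D q) := by
  have hk : N.kind q.1.1.val = NK.evar :=
    (N.kind_evar q.1.1.val (lt_of_lt_of_le q.1.1.isLt N.u_le)).2 q.1.1.isLt
  refine ⟨hk, ?_⟩
  unfold CValid auxClone
  have h := N.fd_eq q.1.1.val (lt_of_lt_of_le q.1.1.isLt N.u_le)
  rw [hk] at h
  simp only [NK.fdeg] at h
  simp only [h]
  exact q.2

/-- The next chain variable (when it exists). [folklore] -/
def auxNext (q : N.Aux D) (h : q.1.2.val + 2 ≤ D) : N.Aux D :=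
  ⟨(q.1.1, ⟨q.1.2.val + 1, by omega⟩), by simp only; omega⟩

/-- **The two occurrences of each variable** (factor index, slot index): a token occurs as an
outgoing slot of its source clone and as an incoming slot of its target clone; `t₀` in the root
factor and in the root clone; a chain variable `a_{k,c}` in the factor of the clone `(k, c)` and
in that of `(k, c+1)` (or the chain end). [folklore] -/
noncomputable def occ : N.Var D → Bool → Fin (N.mF D) × ℕ
  | Sum.inl τ, false => (N.enc D (Sum.inl τ.1.1), τ.1.2.val)
  | Sum.inl τ, true => (N.enc D (Sum.inl (N.tgtC D τ)),
      (N.cloneKind D (N.tgtC D τ)).pre + N.posIn D (N.ins D (N.tgtC D τ)) (Sum.inl τ))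
  | Sum.inr (Sum.inl _), false => (N.enc D (Sum.inr (Sum.inl 0)), 0)
  | Sum.inr (Sum.inl _), true => (N.enc D (Sum.inl (N.rootC D hm)),
      (N.cloneKind D (N.rootC D hm)).pre + N.posIn D (N.ins D (N.rootC D hm)) (N.t0 D))
  | Sum.inr (Sum.inr q), false => (N.enc D (Sum.inl (N.auxClone D q)), if q.1.2.val = 0 then 0 else 1)
  | Sum.inr (Sum.inr q), true =>
      if h : q.1.2.val + 2 ≤ D then (N.enc D (Sum.inl (N.auxClone D (N.auxNext D q h))), 0)
      else (N.enc D (Sum.inr (Sum.inr q.1.1)), 0)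

/-- The second occurrence of a chain variable that has a successor. [folklore] -/
theorem occ_aux_true_of (q : N.Aux D) (h : q.1.2.val + 2 ≤ D) :
    N.occ D hm (Sum.inr (Sum.inr q)) true = (N.enc D (Sum.inl (N.auxClone D (N.auxNext D q h))), 0) := by
  simp [occ, h]

/-- The second occurrence of the last chain variable. [folklore] -/
theorem occ_aux_true_of_not (q : N.Aux D) (h : ¬ q.1.2.val + 2 ≤ D) :
    N.occ D hm (Sum.inr (Sum.inr q)) true = (N.enc D (Sum.inr (Sum.inr q.1.1)), 0) := by
  simp [occ, h]

end Occ

/-! ### Slot lemmas -/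

section Slots

variable (D : ℕ) (hm : 0 < N.m)

/-- **Source slots.** The `j`-th outgoing token of a clone is its `j`-th slot, before the
incoming ones. [folklore] -/
theorem slots_src (τ : N.Tok D) :
    τ.1.2.val < (N.cloneKind D τ.1.1).pre ∧
      ∀ h, (N.cloneKind D τ.1.1).slots.get ⟨τ.1.2.val, h⟩ = Sum.inl τ := by
  obtain ⟨⟨κ, j⟩, hv, hj⟩ := τ
  simp only
  rw [N.cloneKind_eq D κ hv rfl]
  have e : ∀ (k : NK R) (hk : N.kind κ.1.val = k) (hj : j.val < k.ar),
      j.val < (N.cloneKindOf D κ hv k hk).pre ∧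
        ∀ h, (N.cloneKindOf D κ hv k hk).slots.get ⟨j.val, h⟩ =
          Sum.inl ⟨(κ, j), hv, by rw [hk]; exact hj⟩ := by
    intro k hk hj
    cases k with
    | leaf ℓ => simp [NK.ar] at hj
    | evar => simp [NK.ar] at hj
    | mul a b =>
      refine ⟨by simp only [cloneKindOf, FKind.pre]; simp [NK.ar] at hj; omega, fun h => ?_⟩
      fin_cases j <;> rfl
    | add a b =>
      refine ⟨by simp only [cloneKindOf, FKind.pre]; simp [NK.ar] at hj; omega, fun h => ?_⟩
      fin_cases j <;> rfl
    | pass c a =>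
      refine ⟨by simp only [cloneKindOf, FKind.pre]; simp [NK.ar] at hj; omega, fun h => ?_⟩
      fin_cases j
      · rfl
      · simp [NK.ar] at hj
  exact e _ rfl hj

/-- **Target slots.** An incoming variable of a valid clone sits at the slot `pre + posIn`. [folklore] -/
theorem slots_ins (κ : N.Clone D) (hv : N.CValid D κ) (v : N.Var D) (hmem : v ∈ N.ins D κ) :
    (N.cloneKind D κ).pre + N.posIn D (N.ins D κ) v < (N.cloneKind D κ).slots.length ∧
      ∀ h, (N.cloneKind D κ).slots.get ⟨(N.cloneKind D κ).pre + N.posIn D (N.ins D κ) v, h⟩ = v := by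
  have hlt := N.posIn_lt D hmem
  refine ⟨?_, fun h => ?_⟩
  · rw [FKind.slots_length, N.cloneKind_ins D κ hv]
    omega
  · rw [FKind.get_slots_pre_add]
    simp only [List.get_eq_getElem, N.cloneKind_ins D κ hv]
    exact N.getElem_posIn D hmem

/-- The incoming slots determine their position. [folklore] -/
theorem posIn_ins_get (κ : N.Clone D) (hv : N.CValid D κ) (i : ℕ)
    (h : (N.cloneKind D κ).pre + i < (N.cloneKind D κ).slots.length) :
    N.posIn D (N.ins D κ) ((N.cloneKind D κ).slots.get ⟨(N.cloneKind D κ).pre + i, h⟩) = i := by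
  rw [FKind.get_slots_pre_add]
  simp only [List.get_eq_getElem, N.cloneKind_ins D κ hv]
  exact N.posIn_getElem D (N.nodup_ins D κ) i _

/-- The clone factor of a chain variable `a_{k,0}` is `chain₀`, with `a_{k,0}` at slot `0`. [folklore] -/
theorem slots_aux_zero (q : N.Aux D) (hc : q.1.2.val = 0) :
    1 ≤ (N.cloneKind D (N.auxClone D q)).pre ∧
      ∀ h, (N.cloneKind D (N.auxClone D q)).slots.get ⟨0, h⟩ = Sum.inr (Sum.inr q) := by
  obtain ⟨hk, hv⟩ := N.auxClone_spec D q
  rw [N.cloneKind_eq D _ hv hk]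
  obtain ⟨⟨k, ⟨c, hc'⟩⟩, hq⟩ := q
  simp only at hc
  subst hc
  exact ⟨le_rfl, fun h => rfl⟩

/-- The clone factor of a chain variable `a_{k,c+1}` is `chain`, with `a_{k,c}` at slot `0` and
`a_{k,c+1}` at slot `1`. [folklore] -/
theorem slots_aux_succ (q : N.Aux D) (c : ℕ) (hc : q.1.2.val = c + 1) :
    2 ≤ (N.cloneKind D (N.auxClone D q)).pre ∧
      (∀ h, (N.cloneKind D (N.auxClone D q)).slots.get ⟨1, h⟩ = Sum.inr (Sum.inr q)) ∧
      ∀ h, (N.cloneKind D (N.auxClone D q)).slots.get ⟨0, h⟩ =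
        Sum.inr (Sum.inr ⟨(q.1.1, ⟨c, by omega⟩), by have := q.2; simp only; omega⟩) := by
  obtain ⟨hk, hv⟩ := N.auxClone_spec D q
  rw [N.cloneKind_eq D _ hv hk]
  obtain ⟨⟨k, ⟨c', hc'⟩⟩, hq⟩ := q
  simp only at hc
  subst hc
  exact ⟨le_rfl, fun h => rfl, fun h => rfl⟩

/-- A chain variable without successor is the last one. [folklore] -/
theorem aux_last (q : N.Aux D) (h : ¬ q.1.2.val + 2 ≤ D) : q.1.2.val = D - 1 := by
  have := q.2; omega

/-- Changing the index pair along an equation (to rewrite under the dependent slot index). [folklore] -/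
theorem get_kindF_congr (hD : 1 ≤ D) {p : Fin (N.mF D) × ℕ} {f : Fin (N.mF D)} {n : ℕ}
    (hp : p = (f, n)) (h : p.2 < (N.kindF D hD p.1).slots.length)
    (h' : n < (N.kindF D hD f).slots.length) :
    (N.kindF D hD p.1).slots.get ⟨p.2, h⟩ = (N.kindF D hD f).slots.get ⟨n, h'⟩ := by
  subst hp
  rfl

end Slots

/-! ### The factor system of a normalized circuit -/

section System

variable (D : ℕ) (hD : 1 ≤ D) (hm : 0 < N.m) (hroot : N.fd (N.m - 1) ≤ D)

/-- `enc ∘ dec = id`. [folklore] -/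
@[simp] theorem enc_dec (f : Fin (N.mF D)) : N.enc D (N.dec D f) = f := Equiv.symm_apply_apply _ _

/-- **Every occurrence is a slot of its variable.** [folklore] -/
theorem occ_spec (hroot : N.fd (N.m - 1) ≤ D) (v : N.Var D) (i : Bool) :
    ∃ (f : Fin (N.mF D)) (n : ℕ), N.occ D hm v i = (f, n) ∧ n < (N.kindF D hD f).slots.length ∧
      ∀ h, (N.kindF D hD f).slots.get ⟨n, h⟩ = v := by
  rcases v with τ | ⟨⟨⟩⟩ | q <;> cases i
  · -- token, source
    refine ⟨_, _, rfl, ?_⟩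
    rw [N.kindF_enc, N.kindΦ_inl]
    exact ⟨(N.slots_src D τ).1.trans_le (by rw [FKind.slots_length]; omega), (N.slots_src D τ).2⟩
  · -- token, target
    refine ⟨_, _, rfl, ?_⟩
    rw [N.kindF_enc, N.kindΦ_inl]
    exact N.slots_ins D _ (N.tgtC_valid D τ) _ (N.inl_mem_ins_tgtC D τ)
  · -- `t₀`, root factor
    refine ⟨_, _, rfl, ?_⟩
    rw [N.kindF_enc, N.kindΦ_root]
    exact ⟨Nat.zero_lt_one, fun h => rfl⟩
  · -- `t₀`, root clone
    refine ⟨_, _, rfl, ?_⟩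
    rw [N.kindF_enc, N.kindΦ_inl]
    exact N.slots_ins D _ (N.rootC_valid D hm hroot) _ (N.t0_mem_ins_rootC D hm)
  · -- chain variable, its own clone
    refine ⟨_, _, rfl, ?_⟩
    rw [N.kindF_enc, N.kindΦ_inl]
    obtain ⟨⟨k, ⟨c, hc⟩⟩, hq⟩ := q
    cases c with
    | zero =>
      have h1 := N.slots_aux_zero D ⟨(k, ⟨0, hc⟩), hq⟩ rfl
      simp only [if_true]
      exact ⟨lt_of_lt_of_le Nat.zero_lt_one (h1.1.trans (by rw [FKind.slots_length]; omega)), h1.2⟩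
    | succ c =>
      have h1 := N.slots_aux_succ D ⟨(k, ⟨c + 1, hc⟩), hq⟩ c rfl
      simp only [Nat.succ_ne_zero, if_false]
      exact ⟨lt_of_lt_of_le Nat.one_lt_two (h1.1.trans (by rw [FKind.slots_length]; omega)), h1.2.1⟩
  · -- chain variable, next clone or chain end
    by_cases h : q.1.2.val + 2 ≤ D
    · refine ⟨_, _, N.occ_aux_true_of D hm q h, ?_⟩
      rw [N.kindF_enc, N.kindΦ_inl]
      have h1 := N.slots_aux_succ D (N.auxNext D q h) q.1.2.val rfl
      exact ⟨lt_of_lt_of_le Nat.zero_lt_two (h1.1.trans (by rw [FKind.slots_length]; omega)),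
        fun h' => h1.2.2 h'⟩
    · refine ⟨_, _, N.occ_aux_true_of_not D hm q h, ?_⟩
      rw [N.kindF_enc, N.kindΦ_fin]
      refine ⟨Nat.zero_lt_one, fun h' => ?_⟩
      have hq := N.aux_last D q h
      obtain ⟨⟨k, ⟨c, hc⟩⟩, hq2⟩ := q
      simp only at hq
      subst hq
      rfl

/-- Surjectivity of the occurrences onto the slots of a valid clone factor. [folklore] -/
theorem occ_surj_clone (κ : N.Clone D) (hv : N.CValid D κ) (j : Fin (N.cloneKind D κ).slots.length) :
    N.occ D hm ((N.cloneKind D κ).slots.get j) false = (N.enc D (Sum.inl κ), j.val) ∨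
      N.occ D hm ((N.cloneKind D κ).slots.get j) true = (N.enc D (Sum.inl κ), j.val) := by
  by_cases hj : (N.cloneKind D κ).pre ≤ j.val
  · -- an incoming slot
    right
    obtain ⟨i, hi⟩ : ∃ i, j.val = (N.cloneKind D κ).pre + i :=
      ⟨j.val - (N.cloneKind D κ).pre, by omega⟩
    have hj' : (N.cloneKind D κ).pre + i < (N.cloneKind D κ).slots.length := hi ▸ j.isLt
    have hget : (N.cloneKind D κ).slots.get j = (N.cloneKind D κ).slots.get ⟨_, hj'⟩ := by
      congr 1
      exact Fin.ext hi
    rw [hget]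
    have hmem : (N.cloneKind D κ).slots.get ⟨_, hj'⟩ ∈ N.ins D κ := by
      rw [FKind.get_slots_pre_add]
      simp only [List.get_eq_getElem, N.cloneKind_ins D κ hv]
      exact List.getElem_mem _
    have hpos := N.posIn_ins_get D κ hv i hj'
    rcases (N.mem_ins_iff D κ _).1 hmem with ⟨τ, hτ, htgt⟩ | ⟨hr, ht0⟩
    · have hC : N.tgtC D τ = κ := by
        unfold tgtC mkClone
        ext <;> simp [htgt]
      rw [hτ] at hpos ⊢
      show (N.enc D (Sum.inl (N.tgtC D τ)), _) = _
      rw [hC, hpos, hi]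
    · have hC : κ = N.rootC D hm := N.eq_rootC_of_isRoot D hr
      subst hC
      rw [ht0] at hpos ⊢
      show (N.enc D (Sum.inl (N.rootC D hm)), _) = _
      rw [hpos, hi]
  · -- a leading slot: by the kind of the node
    have hjlt : j.val < (N.cloneKind D κ).pre := lt_of_not_ge hj
    have key : ∀ (k : NK R) (hk : N.kind κ.1.val = k) (j : Fin (N.cloneKindOf D κ hv k hk).slots.length),
        j.val < (N.cloneKindOf D κ hv k hk).pre →
        N.occ D hm ((N.cloneKindOf D κ hv k hk).slots.get j) false = (N.enc D (Sum.inl κ), j.val) ∨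
          N.occ D hm ((N.cloneKindOf D κ hv k hk).slots.get j) true = (N.enc D (Sum.inl κ), j.val) := by
      intro k hk j hj
      cases k with
      | leaf ℓ => simp [cloneKindOf, FKind.pre] at hj
      | mul a b =>
        left
        simp only [cloneKindOf, FKind.pre] at hj
        obtain ⟨j, hjl⟩ := j
        rcases j with _ | _ | j
        · rfl
        · rfl
        · simp only at hj; omega
      | add a b =>
        left
        simp only [cloneKindOf, FKind.pre] at hj
        obtain ⟨j, hjl⟩ := j
        rcases j with _ | _ | j
        · rfl
        · rfl
        · simp only at hj; omega
      | pass c a =>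
        left
        simp only [cloneKindOf, FKind.pre] at hj
        obtain ⟨j, hjl⟩ := j
        rcases j with _ | j
        · rfl
        · simp only at hj; omega
      | evar =>
        obtain ⟨hu, hc⟩ := N.aux_cond D hv hk rfl
        obtain ⟨⟨i, hi⟩, ⟨c, hcl⟩⟩ := κ
        simp only at hu hc
        cases c with
        | zero =>
          left
          obtain ⟨j, hjl⟩ := j
          simp only [cloneKindOf, evarKind, FKind.pre] at hj hjl ⊢
          rcases j with _ | j
          · rfl
          · omega
        | succ c =>
          obtain ⟨j, hjl⟩ := j
          simp only [cloneKindOf, evarKind, FKind.pre] at hj hjl ⊢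
          rcases j with _ | _ | j
          · right
            show N.occ D hm (Sum.inr (Sum.inr _)) true = _
            rw [N.occ_aux_true_of D hm _ (by simp only; omega)]
            rfl
          · left
            rfl
          · omega
    have hk := N.cloneKind_eq D κ hv rfl
    clear hj
    generalize hK : N.cloneKind D κ = K at j hjlt hk
    subst hk
    exact key _ rfl j hjlt

/-- **Every slot is an occurrence of its variable.** [folklore] -/
theorem occ_surj (f : Fin (N.mF D)) (j : Fin (N.kindF D hD f).slots.length) :
    N.occ D hm ((N.kindF D hD f).slots.get j) false = (f, j.val) ∨
      N.occ D hm ((N.kindF D hD f).slots.get j) true = (f, j.val) := by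
  have key : ∀ (x : N.Φ D) (j : Fin (N.kindΦ D hD x).slots.length),
      N.occ D hm ((N.kindΦ D hD x).slots.get j) false = (N.enc D x, j.val) ∨
        N.occ D hm ((N.kindΦ D hD x).slots.get j) true = (N.enc D x, j.val) := by
    rintro (κ | ⟨z⟩ | k) j
    · by_cases hv : N.CValid D κ
      · exact N.occ_surj_clone D hm κ hv j
      · exfalso
        have := j.isLt
        simp [N.cloneKind_of_not D κ hv, FKind.slots] at this
    · left
      obtain ⟨j, hj⟩ := j
      simp only [kindΦ_root, FKind.slots, List.length_singleton] at hj
      have hj0 : j = 0 := by omega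
      subst hj0
      have hz : z = 0 := Fin.eq_zero z
      subst hz
      rfl
    · right
      obtain ⟨j, hj⟩ := j
      simp only [kindΦ_fin, FKind.slots, List.length_singleton] at hj
      have hj0 : j = 0 := by omega
      subst hj0
      show N.occ D hm (Sum.inr (Sum.inr _)) true = _
      rw [N.occ_aux_true_of_not D hm _ (by simp only; omega)]
  have h := key (N.dec D f) j
  rwa [N.enc_dec] at h

/-- **The two occurrences lie in different factors.** [folklore] -/
theorem occ_ne (v : N.Var D) : (N.occ D hm v false).1 ≠ (N.occ D hm v true).1 := by
  rcases v with τ | ⟨⟨⟩⟩ | q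
  · simp only [occ]
    intro h
    have h' := Sum.inl.inj (N.enc_injective D h)
    have := N.tgtC_node_lt D τ
    rw [← h'] at this
    exact lt_irrefl _ this
  · simp only [occ]
    intro h
    exact Sum.inl_ne_inr (N.enc_injective D h).symm
  · by_cases h : q.1.2.val + 2 ≤ D
    · rw [N.occ_aux_true_of D hm q h]
      simp only [occ]
      intro h'
      have h'' := congrArg (fun κ : N.Clone D => κ.2.val) (Sum.inl.inj (N.enc_injective D h'))
      simp [auxClone, auxNext] at h''
    · rw [N.occ_aux_true_of_not D hm q h]
      simp only [occ]
      intro h'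
      exact Sum.inl_ne_inr (N.enc_injective D h')

/-- **The factor system of a normalized circuit** with budget `D ≥ fd(root)`, `D ≥ 1`, `m ≥ 1`:
variables = tokens, `t₀`, chain variables; factors = the clone factors, the root factor
`[t₀]`, the chain ends. Every variable is read exactly twice, in two different factors. [cite: MalodPortier2008, Thm. 2] -/
noncomputable def FS (hroot : N.fd (N.m - 1) ≤ D) : FactorSystem R where
  V := N.Var D
  m := N.mF D
  kind := N.kindF D hD
  occ := N.occ D hm
  occ_lt v i := by
    obtain ⟨f, n, hp, hn, -⟩ := N.occ_spec D hD hm hroot v i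
    rw [hp]
    exact hn
  occ_var v i := by
    obtain ⟨f, n, hp, hn, hget⟩ := N.occ_spec D hD hm hroot v i
    rw [N.get_kindF_congr D hD hp _ hn]
    exact hget hn
  occ_surj := N.occ_surj D hD hm
  occ_ne := N.occ_ne D hm

end System

end NCirc

end Literature.Computability.AlgebraicComplexity
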